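import Mathlib.Algebra.Order.Field.Basic
import Mathlib.Algebra.Order.BigOperators.Group.Finset
import Mathlib.Tactic.Ring
import Mathlib.Tactic.Linarith
import Mathlib.Tactic.Positivity
import Mathlib.Tactic.FieldSimp
import Summits.Ventures.CertifiedArithmetic.LowPrec.SREnvelopes
import HarnessLib

/-!
# Stochastic rounding into a finite format, IV: ANY accumulation order (summation trees) — the model

HONEST FRAMING: certified error envelopes and provably optimal rounding/accumulation schemes for
low-precision formats under stated cost models; every table by two implementations; no hardware or
vendor claims.

Files I–III (`SRStep`, `SRAccumulation`, `SREnvelopes`) treat RECURSIVE (sequential) summation.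
Here the accumulation ORDER is an arbitrary binary summation tree `STree K` (leaves = the exact
summands; pairwise, blocked / split-K and sequential orders are instances): every internal node
returns a FRESH saturating mode-2 stochastic rounding `SR(a + b)` of the sum of the values returned
by its two subtrees, which are evaluated INDEPENDENTLY. The law of the root value `ŝ_T` is again a
finite outcome tree and we work with the exact backward recursion
`treeExp F T f = E[f(ŝ_T)]` — nested two-term sums, exact in `K`, `decide`-evaluable on concrete
formats.

This file: `STree` (with `exact`, `leaves`, `nodes = leaves − 1` = number of roundings, `height`),
the left comb `comb` (= recursive summation), `treeExp`, the support predicate `AllOut` (every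
possible value of `ŝ_T` satisfies `P`), the node-wise hypotheses `NoSatT` (no node's pre-rounding
value leaves the hull on any branch) and `GapLET G` (every node's candidate gap is `≤ G` on every
branch) — all DECIDABLE via Boolean evaluators (`allOutB_iff`, `noSatTB_iff`, `gapLETB_iff`) so that
concrete instances are kernel certificates; `treeBias` (expected cumulative saturation defect) and
`treeVar` (`∑_{nodes} E[v_F(c_node)]`); linearity / positivity / monotonicity of `treeExp` and the
support-restricted forms (`treeExp_congr_of_allOut`, `treeExp_mono_of_allOut`, `treeExp_le_of_allOut`).
The theorems (mean decomposition, exact variance identity, envelopes `m·G²/4` for every order,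
Chebyshev, comb = `accExp`) are in `SRTreeEnvelopes`.

Placement. In the RELATIVE model (`|δ| ≤ u`, unbounded exponent) pairwise summation under SR has
error `O(√h·u)` w.h.p., `h` the tree height: El Arar–Sohier–de Oliveira Castro–Petit, SISC 2024
(doi:10.1137/23m1563001) and de Oliveira Castro–El Arar–Petit–Sohier, *Error analysis of
sum-product algorithms under stochastic rounding*, arXiv:2411.13601 Thm 4.1 (martingale length =
height; general computation DAGs). The finite-format statements of this series (saturation
criterion, exact variance identity for every tree, envelopes in the number `m` of roundings, kernel
certificates) are this venture's additions; no claim beyond that.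
-/

namespace Summit.Ventures.CertifiedArithmetic.LowPrec.SR

open Literature.ComputerArithmetic.ConnollyHighamMary2021
open Finset

/-! ### Summation trees -/

/-- A summation tree (an evaluation order of `∑ xᵢ`): leaves carry the exact summands, every
internal node is one floating-point addition (here: one stochastic rounding). -/
inductive STree (K : Type*) where
  | leaf : K → STree K
  | node : STree K → STree K → STree K

namespace STree

variable {K : Type*}

/-- The exact sum of the leaves. -/
def exact [Add K] : STree K → K
  | leaf x => x
  | node l r => exact l + exact r

/-- Number of leaves (summands). -/
def leaves : STree K → ℕ
  | leaf _ => 1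
  | node l r => leaves l + leaves r

/-- Number of internal nodes `=` number of roundings performed. -/
def nodes : STree K → ℕ
  | leaf _ => 0
  | node l r => nodes l + nodes r + 1

/-- `nodes + 1 = leaves`: a tree with `n` summands performs `n − 1` roundings, in any order. -/
theorem nodes_add_one : ∀ t : STree K, t.nodes + 1 = t.leaves
  | leaf _ => rfl
  | node l r => by simp only [nodes, leaves, ← nodes_add_one l, ← nodes_add_one r]; omega

/-- Height (longest root-to-leaf path, counted in roundings). -/
def height : STree K → ℕ
  | leaf _ => 0
  | node l r => max (height l) (height r) + 1

/-- Map the leaves (used for the cast `ℚ → ℝ`). -/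
def map {L : Type*} (φ : K → L) : STree K → STree L
  | leaf x => leaf (φ x)
  | node l r => node (map φ l) (map φ r)

end STree

open STree

/-- The LEFT COMB on `n` inputs with start value `s`: `((s + x₀) + x₁) + ⋯ + x_{n−1}` — recursive
summation as a tree. -/
def comb {K : Type*} (x : ℕ → K) (s : K) : ℕ → STree K
  | 0 => .leaf s
  | n + 1 => .node (comb x s n) (.leaf (x n))

variable {K : Type*} [Field K] [LinearOrder K] [IsStrictOrderedRing K]

/-! ### The expectation operator of SR tree evaluation -/

/-- `treeExp F T f = E[f(ŝ_T)]`: a leaf returns its summand exactly; a node evaluates its two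
subtrees independently (values `a`, `b`) and returns a fresh saturating mode-2 SR of `a + b` into
`F`. -/
def treeExp (F : Finset K) : STree K → (K → K) → K
  | .leaf x, f => f x
  | .node l r, f => treeExp F l (fun a => treeExp F r (fun b => step F (a + b) f))

/-- `AllOut F T P`: every possible value of `ŝ_T` (every leaf of the outcome tree) satisfies `P`. -/
def AllOut (F : Finset K) : STree K → (K → Prop) → Prop
  | .leaf x, P => P x
  | .node l r, P => AllOut F l (fun a => AllOut F r (fun b => P (up F (a + b)) ∧ P (dn F (a + b))))

/-- `NoSatT F T`: on every branch, no node's pre-rounding value `a + b` leaves the hull of `F`. -/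
def NoSatT (F : Finset K) : STree K → Prop
  | .leaf _ => True
  | .node l r => NoSatT F l ∧ NoSatT F r ∧ AllOut F l (fun a => AllOut F r (fun b => InHull F (a + b)))

/-- `GapLET F G T`: on every branch, every node's (clamped) pre-rounding value has candidate gap
`⌈c̄⌉ − ⌊c̄⌋ ≤ G`. -/
def GapLET (F : Finset K) (G : K) : STree K → Prop
  | .leaf _ => True
  | .node l r => GapLET F G l ∧ GapLET F G r ∧ AllOut F l (fun a => AllOut F r (fun b =>
      roundUp F (clamp F (a + b)) - roundDown F (clamp F (a + b)) ≤ G))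

/-- Expected cumulative saturation defect `∑_{nodes} E[clamp(c) − c]`. -/
def treeBias (F : Finset K) : STree K → K
  | .leaf _ => 0
  | .node l r => treeBias F l + treeBias F r
      + treeExp F l (fun a => treeExp F r (fun b => clamp F (a + b) - (a + b)))

/-- Accumulated variance `∑_{nodes} E[v_F(clamp c_node)]`. -/
def treeVar (F : Finset K) : STree K → K
  | .leaf _ => 0
  | .node l r => treeVar F l + treeVar F r
      + treeExp F l (fun a => treeExp F r (fun b => srVar F (clamp F (a + b))))

/-! ### Boolean evaluators and decidability (kernel certificates) -/

/-- Boolean evaluator of `AllOut` for a Boolean predicate. -/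
def allOutB (F : Finset K) : STree K → (K → Bool) → Bool
  | .leaf x, p => p x
  | .node l r, p => allOutB F l (fun a => allOutB F r (fun b => p (up F (a + b)) && p (dn F (a + b))))

omit [IsStrictOrderedRing K] in
/-- `AllOut` only depends on the predicate's truth values. -/
theorem allOut_congr (F : Finset K) (t : STree K) {P Q : K → Prop} (h : ∀ v, P v ↔ Q v) :
    AllOut F t P ↔ AllOut F t Q := by
  rw [show P = Q from funext fun v => propext (h v)]

omit [IsStrictOrderedRing K] in
/-- `allOutB` computes `AllOut`. -/
theorem allOutB_iff (F : Finset K) : ∀ (t : STree K) (p : K → Bool),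
    allOutB F t p = true ↔ AllOut F t (fun v => p v = true)
  | .leaf x, p => Iff.rfl
  | .node l r, p => by
      simp only [allOutB, AllOut]
      rw [allOutB_iff F l]
      refine allOut_congr F l (fun a => ?_)
      rw [allOutB_iff F r]
      refine allOut_congr F r (fun b => ?_)
      exact Bool.and_eq_true_iff

/-- `AllOut` is decidable for a decidable predicate (via `allOutB`). -/
instance instDecidableAllOut (F : Finset K) (t : STree K) (P : K → Prop) [DecidablePred P] :
    Decidable (AllOut F t P) :=
  decidable_of_iff (allOutB F t (fun v => decide (P v)) = true)
    ((allOutB_iff F t _).trans (allOut_congr F t (fun _ => decide_eq_true_iff)))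

/-- Boolean evaluator of `NoSatT`. -/
def noSatTB (F : Finset K) : STree K → Bool
  | .leaf _ => true
  | .node l r => noSatTB F l && noSatTB F r
      && allOutB F l (fun a => allOutB F r (fun b => decide (InHull F (a + b))))

omit [IsStrictOrderedRing K] in
/-- `noSatTB` computes `NoSatT`. -/
theorem noSatTB_iff (F : Finset K) : ∀ t : STree K, noSatTB F t = true ↔ NoSatT F t
  | .leaf _ => by simp [noSatTB, NoSatT]
  | .node l r => by
      simp only [noSatTB, NoSatT, Bool.and_eq_true, noSatTB_iff F l, noSatTB_iff F r, and_assoc]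
      refine and_congr_right fun _ => and_congr_right fun _ => ?_
      rw [allOutB_iff F l]
      refine allOut_congr F l (fun a => ?_)
      rw [allOutB_iff F r]
      exact allOut_congr F r (fun b => decide_eq_true_iff)

/-- `NoSatT` is decidable (via `noSatTB`). -/
instance instDecidableNoSatT (F : Finset K) (t : STree K) : Decidable (NoSatT F t) :=
  decidable_of_iff _ (noSatTB_iff F t)

/-- Boolean evaluator of `GapLET`. -/
def gapLETB (F : Finset K) (G : K) : STree K → Bool
  | .leaf _ => true
  | .node l r => gapLETB F G l && gapLETB F G r
      && allOutB F l (fun a => allOutB F r (fun b =>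
        decide (roundUp F (clamp F (a + b)) - roundDown F (clamp F (a + b)) ≤ G)))

omit [IsStrictOrderedRing K] in
/-- `gapLETB` computes `GapLET`. -/
theorem gapLETB_iff (F : Finset K) (G : K) : ∀ t : STree K, gapLETB F G t = true ↔ GapLET F G t
  | .leaf _ => by simp [gapLETB, GapLET]
  | .node l r => by
      simp only [gapLETB, GapLET, Bool.and_eq_true, gapLETB_iff F G l, gapLETB_iff F G r, and_assoc]
      refine and_congr_right fun _ => and_congr_right fun _ => ?_
      rw [allOutB_iff F l]
      refine allOut_congr F l (fun a => ?_)
      rw [allOutB_iff F r]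
      exact allOut_congr F r (fun b => decide_eq_true_iff)

/-- `GapLET` is decidable (via `gapLETB`). -/
instance instDecidableGapLET (F : Finset K) (G : K) (t : STree K) : Decidable (GapLET F G t) :=
  decidable_of_iff _ (gapLETB_iff F G t)

/-! ### The support predicate: monotonicity, conjunction -/

omit [IsStrictOrderedRing K] in
/-- `AllOut` is monotone in the predicate. -/
theorem allOut_mono (F : Finset K) : ∀ (t : STree K) {P Q : K → Prop}, (∀ v, P v → Q v) →
    AllOut F t P → AllOut F t Q
  | .leaf x, _, _, hPQ, h => hPQ x h
  | .node l r, _, _, hPQ, h =>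
      allOut_mono F l (fun _ ha => allOut_mono F r (fun _ hb => ⟨hPQ _ hb.1, hPQ _ hb.2⟩) ha) h

omit [IsStrictOrderedRing K] in
/-- A predicate true everywhere holds on the support. -/
theorem allOut_of_forall (F : Finset K) : ∀ (t : STree K) {P : K → Prop}, (∀ v, P v) →
    AllOut F t P
  | .leaf x, _, h => h x
  | .node l r, _, h => allOut_of_forall F l (fun _ => allOut_of_forall F r (fun _ => ⟨h _, h _⟩))

omit [IsStrictOrderedRing K] in
/-- Conjunction of two support predicates. -/
theorem allOut_and (F : Finset K) : ∀ (t : STree K) {P Q : K → Prop}, AllOut F t P →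
    AllOut F t Q → AllOut F t (fun v => P v ∧ Q v)
  | .leaf _, _, _, hP, hQ => ⟨hP, hQ⟩
  | .node l r, _, _, hP, hQ =>
      allOut_mono F l (fun _ ha => allOut_mono F r
          (fun _ hb => ⟨⟨hb.1.1, hb.2.1⟩, ⟨hb.1.2, hb.2.2⟩⟩) (allOut_and F r ha.1 ha.2))
        (allOut_and F l hP hQ)

omit [IsStrictOrderedRing K] in
/-- For a NODE, every possible value is a format value (no hypothesis on the leaves). -/
theorem allOut_mem_node (F : Finset K) (hF : F.Nonempty) (l r : STree K) :
    AllOut F (.node l r) (fun v => v ∈ F) :=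
  allOut_of_forall F l (fun _ => allOut_of_forall F r (fun _ => ⟨up_mem hF _, dn_mem hF _⟩))

/-! ### Linearity, positivity, monotonicity -/

omit [IsStrictOrderedRing K] in
/-- `treeExp` respects pointwise equality of integrands. -/
theorem treeExp_congr (F : Finset K) (t : STree K) {f g : K → K} (h : ∀ v, f v = g v) :
    treeExp F t f = treeExp F t g := by
  rw [show f = g from funext h]

omit [IsStrictOrderedRing K] in
/-- `treeExp` only depends on the integrand ON THE SUPPORT. -/
theorem treeExp_congr_of_allOut (F : Finset K) : ∀ (t : STree K) {f g : K → K},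
    AllOut F t (fun v => f v = g v) → treeExp F t f = treeExp F t g
  | .leaf x, _, _, h => h
  | .node l r, _, _, h => by
      simp only [treeExp]
      exact treeExp_congr_of_allOut F l (allOut_mono F l (fun a ha =>
        treeExp_congr_of_allOut F r (allOut_mono F r (fun b hb => step_congr F _ hb.1 hb.2) ha)) h)

omit [IsStrictOrderedRing K] in
/-- Total mass one. -/
theorem treeExp_const (F : Finset K) : ∀ (t : STree K) (a : K), treeExp F t (fun _ => a) = a
  | .leaf x, a => rfl
  | .node l r, a => by
      simp only [treeExp]
      have h : (fun a' => treeExp F r (fun b => step F (a' + b) (fun _ => a))) = fun _ => a := by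
        funext a'
        rw [treeExp_congr F r (g := fun _ => a) (fun b => step_const F _ a)]
        exact treeExp_const F r a
      rw [h]; exact treeExp_const F l a

omit [IsStrictOrderedRing K] in
/-- Additivity. -/
theorem treeExp_add (F : Finset K) : ∀ (t : STree K) (f g : K → K),
    treeExp F t (fun v => f v + g v) = treeExp F t f + treeExp F t g
  | .leaf x, f, g => rfl
  | .node l r, f, g => by
      simp only [treeExp]
      rw [← treeExp_add F l]
      refine treeExp_congr F l (fun a => ?_)
      rw [← treeExp_add F r]
      exact treeExp_congr F r (fun b => step_add F _ f g)

omit [IsStrictOrderedRing K] in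
/-- Scalars. -/
theorem treeExp_mul_left (F : Finset K) : ∀ (t : STree K) (a : K) (f : K → K),
    treeExp F t (fun v => a * f v) = a * treeExp F t f
  | .leaf x, a, f => rfl
  | .node l r, a, f => by
      simp only [treeExp]
      rw [← treeExp_mul_left F l]
      refine treeExp_congr F l (fun a' => ?_)
      rw [← treeExp_mul_left F r]
      exact treeExp_congr F r (fun b => step_mul_left F _ a f)

omit [IsStrictOrderedRing K] in
/-- Subtraction of a constant. -/
theorem treeExp_sub_const (F : Finset K) (t : STree K) (f : K → K) (c : K) :
    treeExp F t (fun v => f v - c) = treeExp F t f - c := by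
  have h := treeExp_add F t f (fun _ => -c)
  rw [treeExp_const] at h
  rw [← sub_eq_add_neg] at h
  rw [← h]
  exact treeExp_congr F t (fun v => sub_eq_add_neg _ _)

omit [IsStrictOrderedRing K] in
/-- Addition of a constant. -/
theorem treeExp_add_const (F : Finset K) (t : STree K) (f : K → K) (c : K) :
    treeExp F t (fun v => f v + c) = treeExp F t f + c := by
  rw [treeExp_add F t f (fun _ => c), treeExp_const]

/-- Monotonicity. -/
theorem treeExp_mono (F : Finset K) : ∀ (t : STree K) {f g : K → K}, (∀ v, f v ≤ g v) →
    treeExp F t f ≤ treeExp F t g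
  | .leaf x, _, _, h => h x
  | .node l r, _, _, h =>
      treeExp_mono F l (fun _ => treeExp_mono F r (fun _ => step_mono F _ h))

/-- Monotonicity ON THE SUPPORT. -/
theorem treeExp_mono_of_allOut (F : Finset K) : ∀ (t : STree K) {f g : K → K},
    AllOut F t (fun v => f v ≤ g v) → treeExp F t f ≤ treeExp F t g
  | .leaf x, _, _, h => h
  | .node l r, _, _, h => by
      simp only [treeExp]
      refine treeExp_mono_of_allOut F l (allOut_mono F l (fun a ha => ?_) h)
      refine treeExp_mono_of_allOut F r (allOut_mono F r (fun b hb => ?_) ha)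
      unfold step
      have hp := pUp_nonneg F (a + b)
      have hq : 0 ≤ 1 - pUp F (a + b) := sub_nonneg.mpr (pUp_le_one F _)
      exact add_le_add (mul_le_mul_of_nonneg_left hb.1 hp) (mul_le_mul_of_nonneg_left hb.2 hq)

/-- Positivity. -/
theorem treeExp_nonneg (F : Finset K) (t : STree K) {f : K → K} (h : ∀ v, 0 ≤ f v) :
    0 ≤ treeExp F t f := by
  have := treeExp_mono F t (f := fun _ => (0 : K)) (g := f) h
  rwa [treeExp_const] at this

/-- An integrand bounded by `M` on the support has expectation `≤ M`. -/
theorem treeExp_le_of_allOut (F : Finset K) (t : STree K) {f : K → K} {M : K}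
    (h : AllOut F t (fun v => f v ≤ M)) : treeExp F t f ≤ M := by
  have := treeExp_mono_of_allOut F t (f := f) (g := fun _ => M) h
  rwa [treeExp_const] at this

/-- An integrand bounded below by `M` on the support has expectation `≥ M`. -/
theorem le_treeExp_of_allOut (F : Finset K) (t : STree K) {f : K → K} {M : K}
    (h : AllOut F t (fun v => M ≤ f v)) : M ≤ treeExp F t f := by
  have := treeExp_mono_of_allOut F t (f := fun _ => M) (g := f) h
  rwa [treeExp_const] at this

/-- The accumulated variance is nonnegative. -/
theorem treeVar_nonneg (F : Finset K) : ∀ t : STree K, 0 ≤ treeVar F t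
  | .leaf _ => le_rfl
  | .node l r => by
      simp only [treeVar]
      refine add_nonneg (add_nonneg (treeVar_nonneg F l) (treeVar_nonneg F r)) ?_
      exact treeExp_nonneg F l (fun a => treeExp_nonneg F r (fun b => srVar_nonneg F _))


end Summit.Ventures.CertifiedArithmetic.LowPrec.SR
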